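import Literature.AnabelianGeometry.SemiGraphs.TieBranchClause
import Literature.AnabelianGeometry.SemiGraphs.EdgeSectionMonoAnyEdge
import Literature.AnabelianGeometry.Anabelioids.OverStarExact

/-!
# The canonical labels are an ALIGNED local witness ([SemiAnbd] Def. 2.2 (i) p. 23, Rem. 2.2.1 p. 24)

Mochizuki, *Semi-graphs of anabelioids*, Publ. RIMS **42** (2006) 221–322, §2, Def. 2.2 (i) p. 23: the
vertices and edges of the finite étale covering `ℋ → 𝒦` attached to `A ∈ B(𝒦)` ARE the connected
components of the `A_u`, `A_e`, the constituent at such a vertex/edge being the component anabelioid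
`(𝒦_u)_P`, `(𝒦_e)_Q` [cite: MochizukiSemiAnbd2006, Def. 2.2(i) p.23].

PROOF-ONLY companion (abc-iut cell, layer L3; FACT-LIST row F-1478 `remark_2_4_1_covering`, brick (T-δ)
of `HOME/staging/f/f-161/J1-TIE-ROUTE.md`, the form Route T / (J1) wants: a local description whose
labels AGREE with the global witness; seat abc-iut-f-161).  In the cell's covering notion the local
labels `cV`, `cE` of `IsFiniteEtaleCoveringOf` and the global witness `αψ`, `e_ψ` are independent data;
the canonical labels `O(w)`, `O(e′)` of `TieLabels` (components through which the tautological section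
factors) are tied to the global witness by construction.  Here: **they are themselves the labels of a
local description** — for connected `ℋ`, `𝒦` and a four-clause covering:

* `nonempty_isoE_of_sectionMapE` — at an EDGE: the local witness object `Q ↪ A_{ψ e′}` is isomorphic to
  `O(e′)` through abc-iut-w4-d079's edge section map `σ_{e′}` (`map_sectionMapE_basePoint_std`,
  `sectionMapE_mono`), the edge twin of `TieLabels.nonempty_iso_of_localGlobalSection`;
* `exists_alignedLocalWitness` — **labels `O`, `O_E` which are bijections, through which the
  tautological section factors (and only through them), whose component anabelioids carry the
  constituent equivalences `ψ_w^* ≅ (O w × −) ⋙ α_w`, `ψ_{e′}^* ≅ (O e′ × −) ⋙ α_{e′}`, and which satisfy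
  the branch clause** — i.e. an `IsFiniteEtaleCoveringOf`-witness ALIGNED with `(αψ, e_ψ)`.

No `def`, no new `Prop`; nothing here takes a side on [IUTchIII] Cor. 3.12.
-/

namespace Literature.AnabelianGeometry.SemiGraphs

namespace SemiGraphOfAnabelioids

namespace Hom

open CategoryTheory CategoryTheory.Limits CategoryTheory.PreGaloisCategory
open Literature.AnabelianGeometry.Anabelioids

universe v₁ u₁ u

variable {ℋ 𝒦 : SemiGraphOfAnabelioids.{v₁, u₁, u}} (ψ : Hom ℋ 𝒦) (A : 𝒦.BObj)
  [HasBinaryProducts 𝒦.BObj] (αψ : Over A ⥤ ℋ.BObj) [αψ.IsEquivalence]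
  (eψ : ψ.pullbackFunctor ≅ Over.star A ⋙ αψ)

/-! ### At an edge: the local witness object is the edge label -/

set_option backward.isDefEq.respectTransparency false in
/-- **The local edge witness object IS the edge label.**  Let `ψ` carry the local description of the
covering of `A`, be branch- and vertex-aligned, with global witness `αψ`, `e_ψ`; let `(α_{e′}, e_{e′})` be a
local witness at the edge `e′` on a CONNECTED sub-object `Q ↪ A_{ψ e′}`, and `P ⊆ A_{ψ e′}` the component
through which `g_{e′}` factors.  Then abc-iut-w4-d079's edge section map `σ_{e′} : Q ⟶ A_{ψ e′}` factors
through `P` by an ISOMORPHISM `Q ≅ P`: `F(σ_{e′})` sends the local edge base point to the global one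
(`map_sectionMapE_basePoint_std`), which lies in `F(P)`, and `σ_{e′}` is a monomorphism
(`sectionMapE_mono`). [cite: MochizukiSemiAnbd2006, Rem. 2.2.1 p.24] -/
theorem nonempty_isoE_of_sectionMapE (hloc : ψ.IsFiniteEtaleCoveringOf A) (hal : ψ.IsBranchAligned)
    (hva : ψ.IsVertexAligned) (e' : ℋ.graph.Edge) (Q : 𝒦.E (ψ.base.edgeMap e'))
    [PreGaloisCategory.IsConnected Q] (mQ : Q ⟶ A.T (ψ.base.edgeMap e')) [Mono mQ]
    (αE : Over Q ⥤ ℋ.E e') [αE.IsEquivalence]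
    (eEloc : (ψ.φE e' (ψ.base.edgeMap e') rfl).pullback ≅ Over.star Q ⋙ αE)
    (hT : IsTerminal ((αψ ⋙ ℋ.ρE e' ⋙ αE.inv).obj (Over.mk (𝟙 A))))
    (P : π₀Obj (A.T (ψ.base.edgeMap e')))
    (hP : ∃ k : (αψ.obj (Over.mk (𝟙 A))).T e' ⟶
        (ψ.φE e' (ψ.base.edgeMap e') rfl).pullback.obj (P.1 : 𝒦.E (ψ.base.edgeMap e')),
      k ≫ (ψ.φE e' (ψ.base.edgeMap e') rfl).pullback.map P.1.arrow =
        (αψ.map ((Over.forgetAdjStar A).unit.app (Over.mk (𝟙 A))) ≫ eψ.inv.app A).fT e') :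
    ∃ k : Q ≅ (P.1 : 𝒦.E (ψ.base.edgeMap e')),
      k.hom ≫ P.1.arrow =
        OverStar.sectionMap (Over.forgetAdjStar A) (Over.forgetAdjStar Q)
          (αψ ⋙ ℋ.ρE e' ⋙ αE.inv) (𝒦.ρE (ψ.base.edgeMap e'))
          (Functor.isoWhiskerRight eψ.symm (ℋ.ρE e' ⋙ αE.inv) ≪≫
            Functor.isoWhiskerRight
              (ψ.reindexIso e' (ψ.base.edgeMap e') (ψ.base.edgeMap e') rfl rfl) αE.inv ≪≫
            Functor.isoWhiskerLeft (𝒦.ρE (ψ.base.edgeMap e')) (Functor.isoWhiskerRight eEloc αE.inv) ≪≫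
            Functor.isoWhiskerLeft (𝒦.ρE (ψ.base.edgeMap e') ⋙ Over.star Q)
              αE.asEquivalence.unitIso.symm :
              Over.star A ⋙ (αψ ⋙ ℋ.ρE e' ⋙ αE.inv) ≅ 𝒦.ρE (ψ.base.edgeMap e') ⋙ Over.star Q) hT := by
  -- basepoints `F_{e′}` of `ℋ_{e′}`, `F := ψ_{e′}^* ⋙ F_{e′}`
  let Fe' := GaloisCategory.getFiberFunctor (ℋ.E e')
  let F : 𝒦.E (ψ.base.edgeMap e') ⥤ FintypeCat.{v₁} := (ψ.φE e' (ψ.base.edgeMap e') rfl).pullback ⋙ Fe'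
  haveI : FiberFunctor F := fiberFunctor_comp_of_exact _ Fe'
  obtain ⟨eT⟩ := nonempty_equiv_fiber_terminal_punit Fe'
  obtain ⟨-, -, hρE⟩ := ℋ.hasLimitsOfShape_bObj (J := Discrete PEmpty.{1})
  haveI := hρE e'
  have hTA : IsTerminal ((ℋ.ρE e').obj (αψ.obj (Over.mk (𝟙 A)))) :=
    (Over.mkIdTerminal.isTerminalObj αψ _).isTerminalObj (ℋ.ρE e') _
  let iA : (ℋ.ρE e').obj (αψ.obj (Over.mk (𝟙 A))) ≅ ⊤_ (ℋ.E e') := hTA.uniqueUpToIso terminalIsTerminal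
  haveI hsA : Subsingleton (Fe'.obj ((αψ.obj (Over.mk (𝟙 A))).T e')) :=
    ((FintypeCat.equivEquivIso.symm (Fe'.mapIso iA)).trans eT).subsingleton
  let t : (ℋ.ρE e' ⋙ Fe').obj (αψ.obj (Over.mk (𝟙 A))) :=
    (FintypeCat.equivEquivIso.symm (Fe'.mapIso iA)).symm (eT.symm PUnit.unit)
  have hTQ : IsTerminal (αE.obj (Over.mk (𝟙 Q))) := Over.mkIdTerminal.isTerminalObj αE _
  let iQ : αE.obj (Over.mk (𝟙 Q)) ≅ ⊤_ (ℋ.E e') := hTQ.uniqueUpToIso terminalIsTerminal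
  let t' : Fe'.obj (αE.obj (Over.mk (𝟙 Q))) :=
    (FintypeCat.equivEquivIso.symm (Fe'.mapIso iQ)).symm (eT.symm PUnit.unit)
  -- `F(σ_{e′})(q₀)` is the global edge base point, which lies in `F(P)`
  have hbase := map_sectionMapE_basePoint_std ψ A αψ eψ e' (ψ.base.edgeMap e') rfl Q αE eEloc hT
    Fe' F (Iso.refl F) t t'
  have hPmem := (sectionE_factors_iff_mem_range ψ A αψ eψ e' Fe' t P).mp hP
  have hmem : F.map (OverStar.sectionMap (Over.forgetAdjStar A) (Over.forgetAdjStar Q)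
          (αψ ⋙ ℋ.ρE e' ⋙ αE.inv) (𝒦.ρE (ψ.base.edgeMap e'))
          (Functor.isoWhiskerRight eψ.symm (ℋ.ρE e' ⋙ αE.inv) ≪≫
            Functor.isoWhiskerRight
              (ψ.reindexIso e' (ψ.base.edgeMap e') (ψ.base.edgeMap e') rfl rfl) αE.inv ≪≫
            Functor.isoWhiskerLeft (𝒦.ρE (ψ.base.edgeMap e')) (Functor.isoWhiskerRight eEloc αE.inv) ≪≫
            Functor.isoWhiskerLeft (𝒦.ρE (ψ.base.edgeMap e') ⋙ Over.star Q)
              αE.asEquivalence.unitIso.symm :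
              Over.star A ⋙ (αψ ⋙ ℋ.ρE e' ⋙ αE.inv) ≅ 𝒦.ρE (ψ.base.edgeMap e') ⋙ Over.star Q) hT)
        ((Iso.refl F).hom.app Q (Fe'.map (αE.map ((Over.forgetAdjStar Q).unit.app (Over.mk (𝟙 Q))) ≫
          eEloc.inv.app Q) t')) ∈ Set.range (F.map P.1.arrow) := by
    rw [hbase]
    change (Fe'.map ((ψ.reindexIso e' (ψ.base.edgeMap e') (ψ.base.edgeMap e') rfl rfl).hom.app A) ≫
        𝟙 _) (Fe'.map ((αψ.map ((Over.forgetAdjStar A).unit.app (Over.mk (𝟙 A))) ≫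
          eψ.inv.app A).fT e') t) ∈ Set.range (F.map P.1.arrow)
    rw [reindexIso_rfl_eq, Iso.refl_hom, NatTrans.id_app, Fe'.map_id, Category.comp_id,
      FintypeCat.id_apply]
    exact hPmem
  obtain ⟨k, hk⟩ := (factor_iff_map_mem_range F P.1.arrow _ _).mpr hmem
  -- `σ_{e′}` is a monomorphism, so the factor is an isomorphism
  haveI := sectionMapE_mono ψ A αψ eψ hloc hal hva e' (ψ.base.edgeMap e') rfl mQ αE eEloc hT
  haveI : Mono k := mono_of_mono_fac hk
  haveI := P.2
  haveI : IsIso k := IsConnected.noTrivialComponent _ k (IsConnected.notInitial (X := Q))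
  exact ⟨asIso k, hk⟩

/-! ### The aligned local witness -/

/-- **The canonical labels are the labels of a local description** ([SemiAnbd] Def. 2.2 (i): vertices and
edges of the covering = components of the `A_u`, `A_e`; constituents = the component anabelioids).  For a
morphism `ψ : ℋ → 𝒦` of connected semi-graphs of anabelioids which is locally the covering attached to
`A`, globally so through `αψ`, `e_ψ`, branch-aligned and vertex-aligned, there are labels `O(w) ⊆ A_{ψ w}`,
`O(e′) ⊆ A_{ψ e′}` with: (1)/(2) `w ↦ (ψ w, O w)`, `e′ ↦ (ψ e′, O e′)` bijective; (3)/(4) characterised by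
the factorisation of the tautological section `g = αψ(η_{𝟙_A}) ≫ e_ψ⁻¹_A`; (5) constituent equivalences
`α_w : (𝒦_u)_{/O w} ⥲ ℋ_w` with `ψ_w^* ≅ (O w × −) ⋙ α_w`; (6) the same at edges; (7) the branch
clause of `Hom.IsFiniteEtaleCoveringOf`.  With properness of `ψ.base` (part of the local clause) this is
an `IsFiniteEtaleCoveringOf`-witness whose labels are TIED to the global witness — the alignment the
cell's independent local/global data lack. [cite: MochizukiSemiAnbd2006, Def. 2.2(i) p.23] -/
theorem exists_alignedLocalWitness (hloc : ψ.IsFiniteEtaleCoveringOf A) (hal : ψ.IsBranchAligned)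
    (hva : ψ.IsVertexAligned) (hℋ : ℋ.IsConnected) (h𝒦 : 𝒦.IsConnected) :
    ∃ (O : ∀ w : ℋ.graph.Vertex, π₀Obj (A.S (ψ.base.vertexMap w)))
      (OE : ∀ e' : ℋ.graph.Edge, π₀Obj (A.T (ψ.base.edgeMap e'))),
      Function.Bijective (fun w : ℋ.graph.Vertex =>
        (⟨ψ.base.vertexMap w, O w⟩ : Σ u, π₀Obj (A.S u))) ∧
      Function.Bijective (fun e' : ℋ.graph.Edge =>
        (⟨ψ.base.edgeMap e', OE e'⟩ : Σ e, π₀Obj (A.T e))) ∧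
      (∀ (w : ℋ.graph.Vertex) (P : π₀Obj (A.S (ψ.base.vertexMap w))),
        P = O w ↔ ∃ k : (αψ.obj (Over.mk (𝟙 A))).S w ⟶
            (ψ.φV w).pullback.obj (P.1 : 𝒦.V (ψ.base.vertexMap w)),
          k ≫ (ψ.φV w).pullback.map P.1.arrow =
            (αψ.map ((Over.forgetAdjStar A).unit.app (Over.mk (𝟙 A))) ≫ eψ.inv.app A).fS w) ∧
      (∀ (e' : ℋ.graph.Edge) (Q : π₀Obj (A.T (ψ.base.edgeMap e'))),
        Q = OE e' ↔ ∃ k : (αψ.obj (Over.mk (𝟙 A))).T e' ⟶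
            (ψ.φE e' (ψ.base.edgeMap e') rfl).pullback.obj (Q.1 : 𝒦.E (ψ.base.edgeMap e')),
          k ≫ (ψ.φE e' (ψ.base.edgeMap e') rfl).pullback.map Q.1.arrow =
            (αψ.map ((Over.forgetAdjStar A).unit.app (Over.mk (𝟙 A))) ≫ eψ.inv.app A).fT e') ∧
      (∀ w : ℋ.graph.Vertex, ∃ α : Over ((O w).1 : 𝒦.V (ψ.base.vertexMap w)) ⥤ ℋ.V w,
        α.IsEquivalence ∧
          Nonempty ((ψ.φV w).pullback ≅ Over.star ((O w).1 : 𝒦.V (ψ.base.vertexMap w)) ⋙ α)) ∧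
      (∀ e' : ℋ.graph.Edge, ∃ α : Over ((OE e').1 : 𝒦.E (ψ.base.edgeMap e')) ⥤ ℋ.E e',
        α.IsEquivalence ∧
          Nonempty ((ψ.φE e' (ψ.base.edgeMap e') rfl).pullback ≅
            Over.star ((OE e').1 : 𝒦.E (ψ.base.edgeMap e')) ⋙ α)) ∧
      (∀ (b' : ℋ.graph.Branch) (v' : ℋ.graph.Vertex) (h' : ℋ.graph.abuts b' = some v'),
        ∃ f : ((OE (ℋ.graph.edgeOf b')).1 : 𝒦.E (ψ.base.edgeMap (ℋ.graph.edgeOf b'))) ⟶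
            (𝒦.transportE (ψ.base.edgeOf_branchMap b')).obj
              ((𝒦.pull (ψ.base.branchMap b') (ψ.base.vertexMap v')
                (ψ.base.abuts_branchMap b' v' h')).pullback.obj ((O v').1 : 𝒦.V (ψ.base.vertexMap v'))),
          f ≫ (𝒦.transportE (ψ.base.edgeOf_branchMap b')).map
                ((𝒦.pull _ _ (ψ.base.abuts_branchMap b' v' h')).pullback.map (O v').1.arrow ≫
                  (A.ψ (ψ.base.branchMap b') (ψ.base.vertexMap v') (ψ.base.abuts_branchMap b' v' h')).hom) ≫
              eqToHom (𝒦.transportE_obj_T A (ψ.base.edgeOf_branchMap b')) =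
            (OE (ℋ.graph.edgeOf b')).1.arrow) := by
  obtain ⟨O, OE, h1, h2, h3, h4, h7⟩ := tie_localLabels ψ A αψ eψ hloc hal hva hℋ h𝒦
  obtain ⟨-, cV, cE, -, -, hαV, hαE, -⟩ := _root_.id hloc
  refine ⟨O, OE, h1, h2, h3, h4, fun w => ?_, fun e' => ?_, h7⟩
  · -- vertices: transport the local witness at `cV w` along `cV w ≅ O w`
    obtain ⟨αw, hαw, ⟨ew⟩⟩ := hαV w
    haveI := hαw
    haveI := (cV w).2
    obtain ⟨k, -⟩ := nonempty_iso_of_localGlobalSection ψ A αψ eψ hva w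
      ((cV w).1 : 𝒦.V (ψ.base.vertexMap w)) (cV w).1.arrow αw ew (O w) ((h3 w (O w)).mp rfl)
    obtain ⟨τ⟩ := nonempty_starMapIso (C := 𝒦.V (ψ.base.vertexMap w)) k.symm
    refine ⟨Over.map k.inv ⋙ αw, inferInstance, ⟨ew ≪≫ Functor.isoWhiskerRight τ.symm αw ≪≫
      Functor.associator _ _ _⟩⟩
  · -- edges: transport the local witness at `cE e′` along `cE e′ ≅ OE e′`
    obtain ⟨αE, hαE', ⟨eE⟩⟩ := hαE e'
    haveI := hαE'
    haveI := (cE e').2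
    obtain ⟨hT⟩ := localGlobalFunctorE_isTerminal A αψ e' (ψ.base.edgeMap e')
      ((cE e').1 : 𝒦.E (ψ.base.edgeMap e')) αE
    obtain ⟨k, -⟩ := nonempty_isoE_of_sectionMapE ψ A αψ eψ hloc hal hva e'
      ((cE e').1 : 𝒦.E (ψ.base.edgeMap e')) (cE e').1.arrow αE eE hT (OE e') ((h4 e' (OE e')).mp rfl)
    obtain ⟨τ⟩ := nonempty_starMapIso (C := 𝒦.E (ψ.base.edgeMap e')) k.symm
    refine ⟨Over.map k.inv ⋙ αE, inferInstance, ⟨eE ≪≫ Functor.isoWhiskerRight τ.symm αE ≪≫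
      Functor.associator _ _ _⟩⟩

end Hom

end SemiGraphOfAnabelioids

end Literature.AnabelianGeometry.SemiGraphs
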